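import Summits.BirchSwinnertonDyer.BirchSwinnertonDyer.Theorems.ErratumRoadFiveEulerHalfGenusLineTwinsGlue
import HarnessLib

/-!
# Line `genus` v2.0 — THIN: the line's vocabulary and its proved cone now live IN THE TREE (`Theorems.GenusLine.*`);
# the crux BY NAME from its four intended children BY NAME (RULING 112 shape of record, pen `bsd-stepL-plan` g45 12:52:59Z)

Crux item stmt-BirchSwinnertonDyer-23444 `Theses.ErratumRoadFive.EulerHalfPOnlyMultPotMultTwinAtFive` (ASIDE of record; served-class
target of crux stmt-BirchSwinnertonDyer-19715 `EulerHalfNotRamNoInertSetAtFive`).  Seat `bsd-idea-9` g26 (line owner, RULING 96 (ii);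
W-71: no route births; W-79: this seat runs NO `ledger skeleton check` — the pen keys).  SUPERSEDES v1.9 (commit 0b77ab8cd161, sha16
db8dd4f847057d98, 2137 l.; registered stubs {`stub_genusEprimeKolyvaginDatumRC`}) WITHOUT loss: every `def` ∕ `structure` of v1.9 is now the
SAME-NAMED tree decl of `Theorems/ErratumRoadFiveEulerHalfGenusLineDefs.lean` + `…GenusTwinsDefs.lean` (namespace
`Summit.BirchSwinnertonDyer.BirchSwinnertonDyer.Theorems.GenusLine`, text verbatim), and every sorry-free theorem of v1.9's cone is the
SAME-NAMED tree theorem of `Theorems/ErratumRoadFiveEulerHalfGenusLine{Setting,Glue,TwinsGlue}.lean`; so this workfile declares ONE theorem.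
TREE PACKAGE (all `--supports stmt-BirchSwinnertonDyer-23444 --as helper`): Defs I p720915 ✓ ∕ Defs II p721733 ✓ (G1 hand `bsd-stepL-tam3-p1` g25;
gate-forced rename `GenusHeegnerPointPrintedFacts ↦ GenusHeegnerPointPrintedFactsBody`), Setting p722920 ✓ ∕ Glue p722946 ✓ ∕ TwinsGlue (+ A3) p723524 ✓ (this seat).

THE SKELETON (v2.0): `EulerHalfPOnlyMultPotMultTwinAtFive_of : GenusMcCallum52 → GenusJetchev53 → GenusClassDataSupply →
GenusLinePrintedInputs → EulerHalfPOnlyMultPotMultTwinAtFive` := `Theorems.GenusLine.eulerHalfPOnlyMultPotMultTwinAtFive_of_genusChildren`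
(kernel-checked in the tree; no `sorry` anywhere in this file).  Its four binders are the four intended CHILDREN of 23444 (pen's split of
record `--split EulerHalfPOnlyMultPotMultTwinAtFive --into GenusMcCallum52 GenusJetchev53 GenusClassDataSupply GenusLinePrintedInputs`,
children typed `:= Theorems.GenusLine.<Name>`; after the split the binders below are DEFINITIONALLY the child items and the pen may
re-type them by the `Theses.ErratumRoadFive.<Name>` aliases with a one-token edit per binder):
* (b1) `GenusMcCallum52` — genus McCallum Prop. 5.2 with `C = {0}` for the CM-presented genus family [McCallumLMS1991, Prop. 5.2];
* (b2a) `GenusJetchev53` — genus Jetchev Prop. 5.3 (non-vanishing of some derived class at a core vertex) [Jetchev2008, Prop. 5.3];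
* (b2b-κ) `GenusClassDataSupply` — the CLASS DATA of the genus family feeding road K's end form (from which (b2b) `GenusJetchevThm63`
  is PROVED: `Theorems.GenusLine.genusJetchevThm63_of_classDataSupply`) [Jetchev2008, §3.1, Props. 4.7, 4.9, Lemma 5.2, Thm. 5.2];
* `GenusLinePrintedInputs` — NON-RESEARCH bundle: the eight ER5 item BODIES (Skinner Thm C, GZK rank ≤ 1, entire L, modularity, Mazur's
  Manin constant, GZ I (7.3), Hoffstein–Luo, Cai–Shu–Tian) ∧ the printed Heegner-point facts of aside 24717 ∧ road K's two local
  print-to-type schemas ([J] Lemma 5.2 (i)–(ii); Howard 2.1.9 (ii)) — support-grade, closes conjunct-by-conjunct as the ER5 items close.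
ALTERNATIVE ROADS KEPT BY NAME IN THE TREE (not binders here): S4♯ `Theorems.GenusLine.EulerHalfPOnlyMultPotMultTwinAtFive_of_printedFacts_of_eprimeDatumSupply`
(items + printed facts + `GenusEprimeKolyvaginDatumSupply` → crux); label (b) `…_of_printedFacts_of_labelB`; the three twins incl. (b2b)
`…_of_printedFacts_of_twins`.  Version history v1 … v1.9: the cards `Lines/genus_turnkey_v1*.md` on 19715 and `Lines/genus.md` on 23444.

HONEST FRAMING: no `sorry`, no axiom, no instance; nothing here closes (b1), (b2a), (b2b-κ), any ER5 item, the crux 23444, its parent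
19715 or any summit statement; BSD is proved for no curve.  References: [Jetchev2008] Thm. 1.4, Cor. 1.5, Props. 5.3, 6.4, Thms. 5.2, 6.3;
[McCallumLMS1991] Prop. 5.2; [GrossLMS1991] §§3–6; [Howard2004HeegnerKolyvagin] Prop. 2.1.9; [Skinner2016PacificMC] Thm. C;
[GrossZagier1986] I (7.3); [CaiShuTian2014] Thm. 1.1.
-/

set_option autoImplicit false
set_option linter.dupNamespace false

namespace Summit.BirchSwinnertonDyer.BirchSwinnertonDyer.Cruxes.EulerHalfPOnlyMultPotMultTwinAtFive.Genus

open Summit.BirchSwinnertonDyer.BirchSwinnertonDyer.Theorems.GenusLine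

/-- **THE SKELETON (v2.0 = RULING 112 shape of record)** — the crux BY NAME from its four intended children BY NAME:
(b1) `GenusMcCallum52`, (b2a) `GenusJetchev53`, (b2b-κ) `GenusClassDataSupply`, and the non-research bundle `GenusLinePrintedInputs`
(eight ER5 item bodies ∧ aside 24717's printed Heegner-point facts ∧ road K's two local schemas), by the tree theorem
`Theorems.GenusLine.eulerHalfPOnlyMultPotMultTwinAtFive_of_genusChildren`.  No `sorry`; every binder OPEN; no summit statement is
proved; BSD is proved for no curve. [cite: Jetchev2008, Thm. 1.4, Prop. 5.3, Thm. 5.2] [cite: McCallumLMS1991, Prop. 5.2] -/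
theorem EulerHalfPOnlyMultPotMultTwinAtFive_of
    (h52 : Summit.BirchSwinnertonDyer.BirchSwinnertonDyer.Theorems.GenusLine.GenusMcCallum52)
    (h53 : Summit.BirchSwinnertonDyer.BirchSwinnertonDyer.Theorems.GenusLine.GenusJetchev53)
    (hκ : Summit.BirchSwinnertonDyer.BirchSwinnertonDyer.Theorems.GenusLine.GenusClassDataSupply)
    (hI : Summit.BirchSwinnertonDyer.BirchSwinnertonDyer.Theorems.GenusLine.GenusLinePrintedInputs) :
    Summit.BirchSwinnertonDyer.BirchSwinnertonDyer.Theses.ErratumRoadFive.EulerHalfPOnlyMultPotMultTwinAtFive :=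
  Summit.BirchSwinnertonDyer.BirchSwinnertonDyer.Theorems.GenusLine.eulerHalfPOnlyMultPotMultTwinAtFive_of_genusChildren
    h52 h53 hκ hI

end Summit.BirchSwinnertonDyer.BirchSwinnertonDyer.Cruxes.EulerHalfPOnlyMultPotMultTwinAtFive.Genus
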